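import Summits.Ventures.DiscreteObjects.PP12.OrderThirteenOmSoundPack
import Summits.Ventures.DiscreteObjects.PP12.OrderThirteenOmSoundWalk
import Summits.Ventures.DiscreteObjects.PP12.DoublyLexical
import Summits.Ventures.DiscreteObjects.PP12.OrderThirteenColumnGram

/-!
# PP(12), order-13 cell: soundness of the kernel enumeration of doubly lexical orbit matrices, IV — the first row, valid doubly lexical lift data give a true matrix, reading the key
Framing: lottery ticket; floor = certified bounds/negative ranges.

Cell pub-namedobj (venture DiscreteObjects), target (M). Text: designs gen 21 (`OrderThirteenOmSearchSound`, verified rc 0 as one file); split into four modules `OrderThirteenOmSoundPack` / `…Walk` / `…Search` / `…First` by designs gen 22 for the gate's 400-line rule (declarations and proofs unchanged).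
Here: the true first row is generated (`first_mem_genM`), every later true row is among the literal candidates once the completeness check succeeds (`rowR_mem_unpackV`),
the literal state after the first row satisfies the invariant (`inv_state1K`), the ROOT theorem `keyM_mem_of_first`; the orbit matrix of VALID doubly lexical lift data is a
true matrix (`trueMat_of_valid`, from `om_equations` / `om_col_equations`; `v_lt_of_toLex_lt`); the ENUMERATION theorem `keyD_mem`; and reading entries back from the key
(`keyM_eq_pack`, `keyM_digit`). No `sorry`, no new axioms; nothing here asserts a census statement.
(designs g24: the local folklore lemma `zipWith_ofFn` was
inlined at its single use — the gate's dedup lint found the same statement already landed in an unrelated Literature module.)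
-/

set_option maxRecDepth 100000

namespace Summit.Ventures.DiscreteObjects.PP12

namespace Om13

open Finset Shape13

/-! ### the first row -/

section first

variable {m : Fin 11 → Fin 11 → ℕ} (T : TrueMat m)
include T

/-- the digits of the true first row are generated by `genM` -/
theorem first_mem_genM : List.ofFn (m 0) ∈ genM 11 12 0 4 := by
  have h4 : ∀ x ∈ List.ofFn (m 0), x ≤ 4 := fun x hx => by obtain ⟨t, rfl⟩ := (List.mem_ofFn' _ _).1 hx; exact T.le4 0 t
  have := mem_genM (List.ofFn (m 0)) 12 0 4 h4 ?_ h4 (by rw [List.sum_ofFn, T.row]) (by rw [List.map_ofFn, List.sum_ofFn, zero_add]; exact T.rowsq 0)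
  · rwa [List.length_ofFn] at this
  · rw [List.pairwise_ofFn]
    intro i j hij
    -- non-increasing first row: from the column condition with no rows above, by induction on the gap
    have step : ∀ k (hk : k + 1 < 11), m 0 ⟨k + 1, hk⟩ ≤ m 0 ⟨k, by omega⟩ := fun k hk => T.cols k hk 0 fun s hs => absurd hs (by simp)
    have hmono : ∀ (n : ℕ) (a b : Fin 11), (b : ℕ) = a + n → m 0 b ≤ m 0 a := by
      intro n
      induction n with
      | zero => intro a b h; rw [show b = a from Fin.ext (by omega)]
      | succ n ih =>
        intro a b h
        have hb : (a : ℕ) + n + 1 < 11 := by have := b.2; omega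
        have h1 := ih a ⟨a + n, by omega⟩ rfl
        have h2 := step (a + n) hb
        rw [show b = ⟨a + n + 1, hb⟩ from Fin.ext (by simp; omega)]
        exact le_trans h2 h1
    exact hmono (j - i) i j (by rw [Fin.lt_def] at hij; omega)

omit T in
/-- `valOf` over an appended list -/
theorem valOf_append (acc : ℕ) (l1 l2 : List ℕ) : valOf acc (l1 ++ l2) = valOf (valOf acc l1) l2 := by
  induction l1 generalizing acc with
  | nil => rfl
  | cons d ds ih => exact ih _

omit T in
/-- the `n` low base-256 digits of `v`, most significant first, after `acc` (proof device: inverse of `valOf`) -/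
def digs : ℕ → ℕ → List ℕ → List ℕ
  | 0, _, acc => acc
  | n + 1, v, acc => digs n (Nat.shiftRight v 8) (Nat.land v 255 :: acc)

omit T in
/-- reading back the digits of a value: `digs n (valOf 0 d) acc = d ++ acc` for `n` digits `< 256` -/
theorem digs_valOf : ∀ (n : ℕ) (d acc : List ℕ), d.length = n → (∀ x ∈ d, x < 256) → digs n (valOf 0 d) acc = d ++ acc
  | 0, d, acc, hl, _ => by rw [List.length_eq_zero_iff.1 hl]; rfl
  | n + 1, d, acc, hl, hd => by
    obtain ⟨d', x, rfl⟩ : ∃ d' x, d = d' ++ [x] := by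
      cases d using List.reverseRecOn with
      | nil => simp at hl
      | append_singleton d' x => exact ⟨d', x, rfl⟩
    rw [List.length_append, List.length_singleton] at hl
    have hx : x < 256 := hd x (by simp)
    have hd' : ∀ y ∈ d', y < 256 := fun y hy => hd y (List.mem_append_left _ hy)
    rw [digs, valOf_append, valOf, valOf, Shape13.land_def, Shape13.shiftRight_def, show (255 : ℕ) = 2 ^ 8 - 1 from rfl, Nat.and_two_pow_sub_one_eq_mod,
      Nat.shiftRight_eq_div_pow, show valOf 0 d' * 256 + x = x + 2 ^ 8 * valOf 0 d' by ring, Nat.add_mul_mod_self_left,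
      Nat.mod_eq_of_lt (show x < 2 ^ 8 by norm_num; exact hx), Nat.add_mul_div_left _ _ (by norm_num), Nat.div_eq_of_lt (show x < 2 ^ 8 by norm_num; exact hx),
      zero_add, digs_valOf n d' (x :: acc) (by omega) hd', List.append_assoc]
    rfl

omit T in
/-- the transported digit list has length `n + |acc|` … -/
theorem digs5_length : ∀ (n w : ℕ) (acc : List ℕ), (digs5 n w acc).length = n + acc.length
  | 0, w, acc => by simp [digs5]
  | n + 1, w, acc => by rw [digs5, digs5_length n]; simp; omega

omit T in
/-- … and digits `< 5` (given that `acc` has) -/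
theorem digs5_lt : ∀ (n w : ℕ) (acc : List ℕ), (∀ x ∈ acc, x < 5) → ∀ x ∈ digs5 n w acc, x < 5
  | 0, w, acc, h => by simpa [digs5] using h
  | n + 1, w, acc, h => by
    rw [digs5]
    exact digs5_lt n _ _ fun x hx => by
      rcases List.mem_cons.1 hx with rfl | hx
      · exact Nat.mod_lt _ (by norm_num)
      · exact h x hx

omit T in
/-- `valOf 0` is injective on digit lists of length `11` with digits `< 256` -/
theorem eq_of_valOf_eq {d d' : List ℕ} (hl : d.length = 11) (hl' : d'.length = 11) (hd : ∀ x ∈ d, x < 256) (hd' : ∀ x ∈ d', x < 256)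
    (h : valOf 0 d = valOf 0 d') : d = d' := by
  have e1 := digs_valOf 11 d [] hl hd
  have e2 := digs_valOf 11 d' [] hl' hd'
  rw [List.append_nil] at e1 e2
  rw [← e1, ← e2, h]

/-- every later true row is among the literal candidates, if the completeness check of the literal list below the true first row succeeds -/
theorem rowR_mem_unpackV {n : ℕ} {Ks : List ℕ} (hchk : chk1 (List.ofFn (m 0)) n Ks = true) (s : Fin 11) (hs : 0 < s) : rowR (m s) ∈ unpackC n Ks := by
  unfold chk1 treeOf at hchk
  have h4 : ∀ x ∈ List.ofFn (m s), x ≤ 4 := fun x hx => by obtain ⟨t, rfl⟩ := (List.mem_ofFn' _ _).1 hx; exact T.le4 s t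
  have hlen : (List.ofFn (m s)).length = 11 := List.length_ofFn ..
  have := chk_sound (List.ofFn (m s)) (List.ofFn (m 0)) 12 0 0 0 (by rw [hlen]; exact hchk) (by simp) h4 (by rw [List.sum_ofFn, T.row])
    (by rw [List.map_ofFn, List.sum_ofFn, zero_add]; exact T.rowsq s)
    (by rw [show List.zipWith (fun x c => x * c) (List.ofFn (m s)) (List.ofFn (m 0)) = List.ofFn (fun i => m s i * m 0 i) from
            List.ext_getElem (by simp) (fun i _ _ => by simp), List.sum_ofFn, zero_add, ← T.cross 0 s (ne_of_lt hs)]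
        exact Finset.sum_congr rfl fun t _ => mul_comm _ _)
  have hv : valOf 0 (List.ofFn (m s)) = (rowR (m s)).v := rfl
  have hv0 : valOf 0 (List.ofFn (m 0)) = (rowR (m 0)).v := rfl
  rcases this with h | h
  · rw [hv, hv0] at h; exact absurd (T.rows 0 s hs) (not_lt.2 h)
  · have hmem := mem_of_buildT (VT.mem_toList h)
    rw [List.mem_map] at hmem
    obtain ⟨w, hw, hwv⟩ := hmem
    unfold unpackC
    refine List.mem_map.2 ⟨w, hw, ?_⟩
    -- the transported row `w` has the digits of the true row
    have hd : digs5 11 w [] = List.ofFn (m s) :=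
      eq_of_valOf_eq (by rw [digs5_length]; rfl) hlen (fun x hx => by have := digs5_lt 11 w [] (by simp) x hx; omega)
        (fun x hx => by have := h4 x hx; omega) hwv
    show rowOf (digs5 11 w []) = rowOf (List.ofFn (m s))
    rw [hd]

/-- **the literal state after the true first row satisfies the invariant** (given the completeness check and sortedness of its candidate list) -/
theorem inv_state1K {n : ℕ} {Ks : List ℕ} (hchk : chk1 (List.ofFn (m 0)) n Ks = true) (hsorted : sortedB (unpackC n Ks) = true) : Inv m (state1K (List.ofFn (m 0)) n Ks) := by
  have e0 : rowOf (List.ofFn (m 0)) = rowR (mN m 0) := by rw [mN_of_lt m (by norm_num)]; rfl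
  exact {
    dle := by simp [state1K]
    chosen := by show [valOf 0 (List.ofFn (m 0))] = chosenOf m 1; rw [chosenOf, chosenOf, ← e0]; rfl
    cs := by show (rowOf (List.ofFn (m 0))).rv = ∑ s ∈ range 1, (rowR (mN m s)).rv; rw [sum_range_one, e0]
    G := by show (rowOf (List.ofFn (m 0))).g = ∑ s ∈ range 1, (rowR (mN m s)).g; rw [sum_range_one, e0]
    tied := by
      intro k hk ht s hs
      change (s : ℕ) < 1 at hs
      have hs0 : s = 0 := Fin.ext (by simp only [Fin.val_zero]; omega)
      subst hs0
      change (newTied 1023 (rowR (m 0)).gt).testBit k = true at ht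
      obtain ⟨-, hnlt⟩ := testBit_newTied ht
      have hle := T.cols k hk 0 fun s hs => absurd hs (by simp)
      have := hnlt hk
      omega
    sorted := pairwise_of_sortedB hsorted
    complete := fun s hs => rowR_mem_unpackV T hchk s (by change 1 ≤ (s : ℕ) at hs; rw [Fin.lt_def]; simp; omega) }

/-- **ROOT THEOREM**: if, for each possible first row, some literal candidate list passes the completeness check, is sorted, and gives a good state, then the key
of every true matrix is listed -/
theorem keyM_mem_of_first {SOLS : List ℕ}
    (hfirst : ∀ d0 ∈ genM 11 12 0 4, ∃ n Ks, chk1 d0 n Ks = true ∧ sortedB (unpackC n Ks) = true ∧ GoodSt SOLS (state1K d0 n Ks)) :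
    memKey (keyM m) SOLS = true := by
  obtain ⟨n, Ks, hc, hs, hg⟩ := hfirst _ (first_mem_genM T)
  exact hg m T (inv_state1K T hc hs)

end first

/-- building the hypothesis of `keyM_mem_of_first` over the literal list of first rows -/
theorem firstAll_cons {SOLS : List ℕ} {d : List ℕ} {ds : List (List ℕ)} {n : ℕ} {Ks : List ℕ} (h1 : chk1 d n Ks = true) (h2 : sortedB (unpackC n Ks) = true)
    (h3 : GoodSt SOLS (state1K d n Ks)) (h : ∀ d0 ∈ ds, ∃ n Ks, chk1 d0 n Ks = true ∧ sortedB (unpackC n Ks) = true ∧ GoodSt SOLS (state1K d0 n Ks)) :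
    ∀ d0 ∈ d :: ds, ∃ n Ks, chk1 d0 n Ks = true ∧ sortedB (unpackC n Ks) = true ∧ GoodSt SOLS (state1K d0 n Ks) := by
  intro d0 hd
  rcases List.mem_cons.1 hd with rfl | hd
  exacts [⟨n, Ks, h1, h2, h3⟩, h d0 hd]

/-- the empty list of first rows -/
theorem firstAll_nil {SOLS : List ℕ} : ∀ d0 ∈ ([] : List (List ℕ)), ∃ n Ks, chk1 d0 n Ks = true ∧ sortedB (unpackC n Ks) = true ∧ GoodSt SOLS (state1K d0 n Ks) :=
  fun _ h => absurd h (by simp)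

/-! ### valid doubly lexical lift data give a true matrix -/

/-- **lexicographically smaller rows pack to smaller numbers** (entries of the smaller one `< 256`) -/
theorem v_lt_of_toLex_lt {f g : Fin 11 → ℕ} (hf : ∀ t, f t < 256) (h : toLex f < toLex g) : (rowR f).v < (rowR g).v := by
  obtain ⟨i, heq, hlt⟩ := (DoublyLex.toLex_lt_toLex_iff f g).1 h
  rw [v_rowR, v_rowR]
  set e0 := 10 - (i : ℕ) with he0
  have hi : (i : ℕ) = 10 - e0 := by have := i.2; omega
  have hsplit : ∀ (u : Fin 11 → ℕ), pack (fun e => ext u (10 - e)) 11 =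
      pack (fun e => ext u (10 - e)) e0 + 256 ^ e0 * (ext u (10 - e0) + 256 * pack (fun e => ext u (10 - (e0 + (e + 1)))) (10 - e0)) := by
    intro u
    have : (11 : ℕ) = e0 + (10 - e0 + 1) := by omega
    conv_lhs => rw [this]
    rw [pack_split, pack_succ']
    simp only [add_zero]
  have hA : ∀ (u : Fin 11 → ℕ), (∀ t, u t < 256) → ∀ e, ext u (10 - e) < 256 := fun u hu e => by
    simp only [ext]; split_ifs <;> simp [hu]
  have hhigh : pack (fun e => ext f (10 - (e0 + (e + 1)))) (10 - e0) = pack (fun e => ext g (10 - (e0 + (e + 1)))) (10 - e0) := by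
    apply pack_congr; intro e he
    have hlt' : 10 - (e0 + (e + 1)) < 11 := by omega
    rw [ext_of_lt f hlt', ext_of_lt g hlt']
    exact heq ⟨_, hlt'⟩ (by rw [Fin.lt_def]; dsimp only; omega)
  have hfi : ext f (10 - e0) = f i := by rw [ext_of_lt f (by omega)]; congr 1; exact Fin.ext (by dsimp only; omega)
  have hgi : ext g (10 - e0) = g i := by rw [ext_of_lt g (by omega)]; congr 1; exact Fin.ext (by dsimp only; omega)
  rw [hsplit f, hsplit g, hhigh, hfi, hgi]
  have hlow : pack (fun e => ext f (10 - e)) e0 < 256 ^ e0 := pack_lt fun e _ => hA f hf e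
  nlinarith [Nat.zero_le (pack (fun e => ext g (10 - e)) e0), Nat.zero_le (pack (fun e => ext g (10 - (e0 + (e + 1)))) (10 - e0))]

/-- **the orbit matrix of valid doubly lexical lift data is a true matrix** (the two order hypotheses are the fields of `LiftData.OmDoublyLex`) -/
theorem trueMat_of_valid (D : LiftData 11 13) (hV : D.Valid) (hLr : ∀ s s' : Fin 11, s < s' → toLex (fun t => D.om s' t) ≤ toLex (fun t => D.om s t))
    (hLc : ∀ t t' : Fin 11, t < t' → toLex (fun s => D.om s t') ≤ toLex (fun s => D.om s t)) : TrueMat fun s t => D.om s t := by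
  obtain ⟨hrow, hint, hx, hcol⟩ := D.om_equations hV
  obtain ⟨hcsq, hcx⟩ := D.om_col_equations hV (by norm_num)
  have h13 : (13 : ℕ) - 1 = 12 := rfl
  simp only [h13] at hrow hint hx hcol hcsq hcx
  have le4 : ∀ s t, D.om s t ≤ 4 := by
    intro s t
    have h1 := Finset.single_le_sum (f := fun t => D.om s t * (D.om s t - 1)) (fun t _ => Nat.zero_le _) (Finset.mem_univ t)
    rw [hint s] at h1
    by_contra h
    have h5 : 5 ≤ D.om s t := by omega
    have : 5 * 4 ≤ D.om s t * (D.om s t - 1) := Nat.mul_le_mul h5 (by omega)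
    omega
  have rowsq : ∀ s, ∑ t, D.om s t * D.om s t = 24 := by
    intro s
    have e : ∀ t, D.om s t * D.om s t = D.om s t * (D.om s t - 1) + D.om s t := fun t => (LiftData.mul_pred_add_self _).symm
    simp_rw [e, sum_add_distrib, hint s, hrow s]
  refine ⟨le4, hrow, rowsq, hx, hcol, fun t => by rw [hcsq t], hcx, ?_, ?_⟩
  · -- rows: doubly lexical + distinct ⇒ numerically decreasing
    intro s s' hss
    have hle := hLr s s' hss
    have hne : (toLex fun t => D.om s' t) ≠ toLex fun t => D.om s t := by
      intro e
      have e' : (fun t => D.om s' t) = fun t => D.om s t := e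
      have := hx s s' (ne_of_lt hss)
      rw [show (∑ t, D.om s t * D.om s' t) = ∑ t, D.om s t * D.om s t from Finset.sum_congr rfl fun t _ => by rw [show D.om s' t = D.om s t from congrFun e' t],
        rowsq s] at this
      exact absurd this (by norm_num)
    exact v_lt_of_toLex_lt (fun t => by have := le4 s' t; omega) (lt_of_le_of_ne hle hne)
  · -- columns: a tied adjacent pair cannot increase
    intro k hk d htied
    by_contra hlt
    push Not at hlt
    have hle := hLc ⟨k, by omega⟩ ⟨k + 1, hk⟩ (by rw [Fin.lt_def]; exact Nat.lt_succ_self _)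
    have hlt' : (toLex fun s => D.om s ⟨k, by omega⟩) < toLex fun s => D.om s ⟨k + 1, hk⟩ :=
      (DoublyLex.toLex_lt_toLex_iff _ _).2 ⟨d, fun j hj => (htied j hj).symm, hlt⟩
    exact absurd hle (not_le.2 hlt')

/-- **ENUMERATION THEOREM**: if every possible first row leads to a sorted candidate list and a good state (established by the kernel runs), the key of the orbit
matrix of every valid doubly lexical lift data is listed -/
theorem keyD_mem {SOLS : List ℕ} (hfirst : ∀ d0 ∈ genM 11 12 0 4, ∃ n Ks, chk1 d0 n Ks = true ∧ sortedB (unpackC n Ks) = true ∧ GoodSt SOLS (state1K d0 n Ks))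
    (D : LiftData 11 13) (hV : D.Valid)
    (hLr : ∀ s s' : Fin 11, s < s' → toLex (fun t => D.om s' t) ≤ toLex (fun t => D.om s t))
    (hLc : ∀ t t' : Fin 11, t < t' → toLex (fun s => D.om s t') ≤ toLex (fun s => D.om s t)) : memKey (keyM fun s t => D.om s t) SOLS = true :=
  keyM_mem_of_first (trueMat_of_valid D hV hLr hLc) hfirst

/-! ### reading the orbit matrix back from its key -/

/-- the key of the first `d` true rows, as a sum of blocks -/
theorem keyOf_chosenOf (m : Fin 11 → Fin 11 → ℕ) (d : ℕ) : keyOf (chosenOf m d) = ∑ j ∈ range d, 256 ^ (11 * j) * (rowR (mN m (d - 1 - j))).v := by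
  induction d with
  | zero => simp [chosenOf, keyOf]
  | succ d ih =>
    rw [chosenOf, keyOf, ih, sum_range_succ', mul_sum]
    simp only [Nat.add_sub_cancel, mul_zero, pow_zero, one_mul, Nat.sub_zero]
    rw [add_comm]
    congr 1
    apply sum_congr rfl; intro j hj
    have hj' := mem_range.1 hj
    rw [show d - (j + 1) = d - 1 - j by omega, show 256 ^ (11 * (j + 1)) = 309485009821345068724781056 * 256 ^ (11 * j) by
      rw [Nat.mul_succ, pow_add, mul_comm]; norm_num]
    ring

/-- the field vector of the key: position `11 j + a` holds entry `(10 − j, 10 − a)` -/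
def keyF (m : Fin 11 → Fin 11 → ℕ) (i : ℕ) : ℕ := ext (mN m (10 - i / 11)) (10 - i % 11)

/-- **the key is the packing of the matrix** -/
theorem keyM_eq_pack (m : Fin 11 → Fin 11 → ℕ) : keyM m = pack (keyF m) (11 * 11) := by
  rw [pack_blocks]
  show keyOf (chosenOf m 11) = _
  rw [keyOf_chosenOf]
  refine sum_congr rfl fun j hj => ?_
  have hj' := mem_range.1 hj
  rw [v_rowR]
  refine congrArg (256 ^ (11 * j) * ·) (pack_congr fun a ha => ?_)
  have e1 : (11 * j + a) / 11 = j := by omega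
  have e2 : (11 * j + a) % 11 = a := by omega
  have e3 : 11 - 1 - j = 10 - j := by omega
  simp only [keyF, e1, e2, e3]

/-- **reading an entry from the key**: with entries `< 256`, the base-256 digit at position `11(10−s) + (10−t)` is `m s t` -/
theorem keyM_digit {m : Fin 11 → Fin 11 → ℕ} (hm : ∀ s t, m s t < 256) (s t : Fin 11) :
    keyM m / 256 ^ (11 * (10 - (s : ℕ)) + (10 - (t : ℕ))) % 256 = m s t := by
  rw [keyM_eq_pack, pack_div_mod]
  · simp only [keyF]
    have hs := s.2; have ht := t.2
    rw [show (11 * (10 - (s : ℕ)) + (10 - t)) / 11 = 10 - s by omega, show (11 * (10 - (s : ℕ)) + (10 - t)) % 11 = 10 - t by omega,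
      show 10 - (10 - (s : ℕ)) = s by omega, show 10 - (10 - (t : ℕ)) = t by omega, mN_of_lt m hs, ext_of_lt _ ht]
  · intro i _
    simp only [keyF, ext, mN]
    split_ifs <;> first | exact hm _ _ | norm_num
  · have := s.2; have := t.2; omega

end Om13

end Summit.Ventures.DiscreteObjects.PP12
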